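import Literature.Geometry.Riemannian.MetricFlowAverageDistanceMonotone
import Literature.Geometry.Riemannian.WassersteinW1Triangle
import HarnessLib

/-!
# Distance distortion between nearby time-slices under mass bounds (Bamler 2023, §4.2, Lemma,
# (4.6))

R. Bamler, *Compactness theory of the space of super Ricci flows*, Invent. Math. 233 (2023), §4.2,
the Lemma that *"will equip us with the necessary distance distortion estimate"*: for an
`H`-concentrated metric flow `𝒳`, a conjugate heat flow `(μ_t)_{t ∈ I'}`, `s ≤ t` in `I'` and
`α, β, γ, r > 0` with `t − s ≤ α r²`, `∫∫ d_t dμ_t dμ_t − ∫∫ d_s dμ_s dμ_s ≤ β r`, and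
`y₁, y₂ ∈ 𝒳_t` with `μ_t(B(y₁, r)) μ_t(B(y₂, r)) ≥ γ`,
`0 ≤ d_t(y₁, y₂) − d^{𝒳_s}_{W₁}(ν_{y₁;s}, ν_{y₂;s}) ≤ ((β + 3√(Hα))/γ + 4) r`     (4.6).
Printed proof: `f := d_t − d_{W₁}(ν_{·;s}, ν_{·;s})` is `2`-Lipschitz in each variable
((c) of the Proposition of §3.2), `f ≥ 0` and `∫∫ f dμ_t dμ_t ≤ βr + 3√(Hα) r` (the Lemma on
almost monotonicity, (4.4)); hence some `y'ᵢ ∈ B(yᵢ, r)` has `f(y'₁, y'₂) ≤ (β + 3√(Hα)) r/γ`,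
and `f(y₁, y₂) ≤ f(y'₁, y₂) + 2r ≤ f(y'₁, y'₂) + 4r`. We follow it, for a compact earlier slice
`𝒳_s` (where (c) is available in the tree) and with the finiteness of `∫∫ d_s dμ_s dμ_s`, which
the printed difference of integrals presupposes, as an explicit hypothesis:

* `MetricFlow.wassersteinW1_condKernel_le_add_edist_left/right` — `y ↦ d_{W₁}(ν_{y;s}, ·)` is
  `1`-Lipschitz (triangle inequality for `d_{W₁}` and (c));
* `MetricFlow.continuous_wassersteinW1_condKernel` — hence jointly continuous;
* `MetricFlow.IsHConcentrated.edist_le_wassersteinW1_condKernel_add` — **(4.6)**.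

Everything is proved; no definitions, no named facts.

## References

* R. H. Bamler, *Compactness theory of the space of super Ricci flows*, Invent. Math. 233 (2023),
  §4.2, Lemma (distance distortion estimate), (4.6). [Bamler2023]
-/

noncomputable section

open Set MeasureTheory ProbabilityTheory Filter Topology Metric
open scoped ENNReal NNReal

namespace Literature.Geometry.Riemannian

universe u

namespace MetricFlow

variable {I : Set ℝ} {𝒳 : MetricFlow.{u} I}

/-! ### `d_{W₁}(ν_{y₁;s}, ν_{y₂;s})` is `1`-Lipschitz in each variable -/

section Lipschitz

variable {s t : I} [CompactSpace (𝒳.Slice s)]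

variable (𝒳) in
/-- **`d_{W₁}(ν_{y₁;s}, ν_{y₂;s}) ≤ d_{W₁}(ν_{y₁';s}, ν_{y₂;s}) + d_t(y₁, y₁')`** (triangle
inequality for `d_{W₁}` and (c) of Bamler 2023, §3.2, Proposition:
`d_{W₁}(ν_{y₁;s}, ν_{y₁';s}) ≤ d_t(y₁, y₁')`), for a compact slice `𝒳_s`, `s ≤ t`.
[cite: Bamler2023, §4.2, proof of the Lemma (distance distortion): f is 2-Lipschitz] -/
theorem wassersteinW1_condKernel_le_add_edist_left (hst : (s : ℝ) ≤ t) (y₁ y₁' y₂ : 𝒳.Slice t) :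
    wassersteinW1 (𝒳.condKernel y₁ s) (𝒳.condKernel y₂ s) ≤
      wassersteinW1 (𝒳.condKernel y₁' s) (𝒳.condKernel y₂ s) + edist y₁ y₁' := by
  haveI := 𝒳.isProbabilityMeasure_condKernel y₁ hst
  haveI := 𝒳.isProbabilityMeasure_condKernel y₁' hst
  haveI := 𝒳.isProbabilityMeasure_condKernel y₂ hst
  haveI : SecondCountableTopology (𝒳.Slice s) := UniformSpace.secondCountable_of_separable _
  calc wassersteinW1 (𝒳.condKernel y₁ s) (𝒳.condKernel y₂ s)
      ≤ wassersteinW1 (𝒳.condKernel y₁ s) (𝒳.condKernel y₁' s) +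
          wassersteinW1 (𝒳.condKernel y₁' s) (𝒳.condKernel y₂ s) := wassersteinW1_triangle _ _ _
    _ ≤ edist y₁ y₁' + wassersteinW1 (𝒳.condKernel y₁' s) (𝒳.condKernel y₂ s) :=
        add_le_add (𝒳.wassersteinW1_condKernel_le_edist hst y₁ y₁') le_rfl
    _ = _ := add_comm _ _

variable (𝒳) in
/-- The symmetric statement in the second variable:
`d_{W₁}(ν_{y₁;s}, ν_{y₂;s}) ≤ d_{W₁}(ν_{y₁;s}, ν_{y₂';s}) + d_t(y₂, y₂')`.
[cite: Bamler2023, §4.2, proof of the Lemma (distance distortion): f is 2-Lipschitz] -/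
theorem wassersteinW1_condKernel_le_add_edist_right (hst : (s : ℝ) ≤ t) (y₁ y₂ y₂' : 𝒳.Slice t) :
    wassersteinW1 (𝒳.condKernel y₁ s) (𝒳.condKernel y₂ s) ≤
      wassersteinW1 (𝒳.condKernel y₁ s) (𝒳.condKernel y₂' s) + edist y₂ y₂' := by
  rw [wassersteinW1_comm (𝒳.condKernel y₁ s), wassersteinW1_comm (𝒳.condKernel y₁ s)]
  exact 𝒳.wassersteinW1_condKernel_le_add_edist_left hst y₂ y₂' y₁

variable (𝒳) in
/-- **`(y₁, y₂) ↦ d_{W₁}(ν_{y₁;s}, ν_{y₂;s})` is continuous on `𝒳_t × 𝒳_t`** (`1`-Lipschitz in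
each variable). [cite: Bamler2023, §4.2, proof of the Lemma (distance distortion): f is 2-Lipschitz] -/
theorem continuous_wassersteinW1_condKernel (hst : (s : ℝ) ≤ t) :
    Continuous fun p : 𝒳.Slice t × 𝒳.Slice t ↦
      wassersteinW1 (𝒳.condKernel p.1 s) (𝒳.condKernel p.2 s) := by
  refine continuous_of_le_add_edist 2 (by norm_num) fun p q ↦ ?_
  calc wassersteinW1 (𝒳.condKernel p.1 s) (𝒳.condKernel p.2 s)
      ≤ wassersteinW1 (𝒳.condKernel q.1 s) (𝒳.condKernel p.2 s) + edist p.1 q.1 :=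
        𝒳.wassersteinW1_condKernel_le_add_edist_left hst _ _ _
    _ ≤ wassersteinW1 (𝒳.condKernel q.1 s) (𝒳.condKernel q.2 s) + edist p.2 q.2 + edist p.1 q.1 :=
        add_le_add (𝒳.wassersteinW1_condKernel_le_add_edist_right hst _ _ _) le_rfl
    _ ≤ wassersteinW1 (𝒳.condKernel q.1 s) (𝒳.condKernel q.2 s) + edist p q + edist p q := by
        gcongr
        · rw [Prod.edist_eq]; exact le_max_right _ _
        · rw [Prod.edist_eq]; exact le_max_left _ _
    _ = wassersteinW1 (𝒳.condKernel q.1 s) (𝒳.condKernel q.2 s) + 2 * edist p q := by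
        rw [two_mul, add_assoc]

end Lipschitz

/-! ### The distance distortion estimate (4.6) -/

/-- **Distance distortion under mass bounds** (Bamler 2023, §4.2, Lemma, (4.6)): in an
`H`-concentrated metric flow with a conjugate heat flow `(μ_t)_{t ∈ I'}`, `s ≤ t` in `I'`, compact
`𝒳_s`, `α, γ, r > 0`, `β ≥ 0` with `t − s ≤ α r²`, `∫∫ d_s dμ_s dμ_s < ∞` and
`∫∫ d_t dμ_t dμ_t ≤ ∫∫ d_s dμ_s dμ_s + β r`, every `y₁, y₂ ∈ 𝒳_t` with
`μ_t(B(y₁, r)) μ_t(B(y₂, r)) ≥ γ` satisfy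
`d_t(y₁, y₂) ≤ d^{𝒳_s}_{W₁}(ν_{y₁;s}, ν_{y₂;s}) + ((β + 3√(Hα))/γ + 4) r` (the lower bound
`0 ≤ d_t − d_{W₁}` being (c) of §3.2, `wassersteinW1_condKernel_le_edist`). Printed proof with
`f = d_t − d_{W₁}(ν_{·;s}, ν_{·;s})`: `∫∫ f dμ_t dμ_t ≤ βr + √(H(t − s)) ≤ (β + 3√(Hα)) r` ((4.4)),
Chebyshev on `B(y₁, r) × B(y₂, r)` gives `y'ᵢ ∈ B(yᵢ, r)` with `f(y'₁, y'₂) ≤ (β + 3√(Hα)) r/γ`,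
and `f(y₁, y₂) ≤ f(y'₁, y'₂) + 4r`.
[cite: Bamler2023, §4.2, Lemma (distance distortion estimate), (4.6)] -/
theorem IsHConcentrated.edist_le_wassersteinW1_condKernel_add {H : ℝ} (hH : 𝒳.IsHConcentrated H)
    (hH0 : 0 ≤ H) {I' : Set ℝ} {μ : ∀ t : I, Measure (𝒳.Slice t)}
    (hμ : 𝒳.IsConjugateHeatFlow I' μ) {s t : I} [CompactSpace (𝒳.Slice s)] (hs : (s : ℝ) ∈ I')
    (ht : (t : ℝ) ∈ I') (hst : (s : ℝ) ≤ t) {α β γ r : ℝ} (hα : 0 < α) (hβ : 0 ≤ β)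
    (hγ : 0 < γ) (hr : 0 < r) (hts : (t : ℝ) - s ≤ α * r ^ 2)
    (hfin : ∫⁻ x₁, ∫⁻ x₂, edist x₁ x₂ ∂(μ s) ∂(μ s) ≠ ∞)
    (hdiff : ∫⁻ y₁, ∫⁻ y₂, edist y₁ y₂ ∂(μ t) ∂(μ t) ≤
      ∫⁻ x₁, ∫⁻ x₂, edist x₁ x₂ ∂(μ s) ∂(μ s) + ENNReal.ofReal (β * r))
    {y₁ y₂ : 𝒳.Slice t}
    (hmass : ENNReal.ofReal γ ≤ μ t (ball y₁ r) * μ t (ball y₂ r)) :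
    edist y₁ y₂ ≤ wassersteinW1 (𝒳.condKernel y₁ s) (𝒳.condKernel y₂ s) +
      ENNReal.ofReal (((β + 3 * Real.sqrt (H * α)) / γ + 4) * r) := by
  haveI := hμ.1 t ht
  haveI : SecondCountableTopology (𝒳.Slice t) := UniformSpace.secondCountable_of_separable _
  -- notation: `W`, `F = d_t − W`
  set W : 𝒳.Slice t × 𝒳.Slice t → ℝ≥0∞ :=
    fun p ↦ wassersteinW1 (𝒳.condKernel p.1 s) (𝒳.condKernel p.2 s) with hW_def
  set F : 𝒳.Slice t × 𝒳.Slice t → ℝ≥0∞ := fun p ↦ edist p.1 p.2 - W p with hF_def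
  have hWc : Continuous W := 𝒳.continuous_wassersteinW1_condKernel hst
  have hFm : Measurable F := measurable_edist.sub hWc.measurable
  have hWle : ∀ p : 𝒳.Slice t × 𝒳.Slice t, W p ≤ edist p.1 p.2 := fun p ↦
    𝒳.wassersteinW1_condKernel_le_edist hst p.1 p.2
  -- `F` is `2`-Lipschitz in each variable
  have hF₁ : ∀ a a' b : 𝒳.Slice t, F (a, b) ≤ F (a', b) + 2 * edist a a' := by
    intro a a' b
    simp only [hF_def]
    rw [tsub_le_iff_right]
    have h1 : W (a', b) ≤ W (a, b) + edist a' a :=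
      𝒳.wassersteinW1_condKernel_le_add_edist_left hst a' a b
    have h2 : edist a' b = (edist a' b - W (a', b)) + W (a', b) :=
      (tsub_add_cancel_of_le (hWle (a', b))).symm
    calc edist a b ≤ edist a a' + edist a' b := edist_triangle _ _ _
      _ = (edist a' b - W (a', b)) + W (a', b) + edist a a' := by rw [← h2, add_comm]
      _ ≤ (edist a' b - W (a', b)) + (W (a, b) + edist a' a) + edist a a' := by gcongr
      _ = (edist a' b - W (a', b)) + 2 * edist a a' + W (a, b) := by
          rw [edist_comm a' a]; ring
  have hF₂ : ∀ a b b' : 𝒳.Slice t, F (a, b) ≤ F (a, b') + 2 * edist b b' := by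
    intro a b b'
    simp only [hF_def]
    rw [tsub_le_iff_right]
    have h1 : W (a, b') ≤ W (a, b) + edist b' b :=
      𝒳.wassersteinW1_condKernel_le_add_edist_right hst a b' b
    have h2 : edist a b' = (edist a b' - W (a, b')) + W (a, b') :=
      (tsub_add_cancel_of_le (hWle (a, b'))).symm
    calc edist a b ≤ edist a b' + edist b' b := edist_triangle _ _ _
      _ = (edist a b' - W (a, b')) + W (a, b') + edist b b' := by rw [← h2, edist_comm b' b]
      _ ≤ (edist a b' - W (a, b')) + (W (a, b) + edist b' b) + edist b b' := by gcongr
      _ = (edist a b' - W (a, b')) + 2 * edist b b' + W (a, b) := by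
          rw [edist_comm b' b]; ring
  -- the integral bound `∫∫ F dμ_t dμ_t ≤ (β + √(Hα)) r ≤ (β + 3√(Hα)) r`
  have hsqrt : (ENNReal.ofReal (H * ((t : ℝ) - s))) ^ (1 / 2 : ℝ) ≤
      ENNReal.ofReal (Real.sqrt (H * α) * r) := by
    rw [ENNReal.ofReal_rpow_of_nonneg (by positivity) (by norm_num), ← Real.sqrt_eq_rpow]
    refine ENNReal.ofReal_le_ofReal ?_
    calc Real.sqrt (H * ((t : ℝ) - s)) ≤ Real.sqrt (H * (α * r ^ 2)) :=
          Real.sqrt_le_sqrt (mul_le_mul_of_nonneg_left hts hH0)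
      _ = Real.sqrt (H * α) * r := by
          rw [← mul_assoc, Real.sqrt_mul (by positivity), Real.sqrt_sq hr.le]
  have hint : ∫⁻ a, ∫⁻ b, F (a, b) ∂(μ t) ∂(μ t) ≤
      ENNReal.ofReal ((β + 3 * Real.sqrt (H * α)) * r) := by
    have h44 := hH.lintegral_lintegral_f_add_le hμ hs ht hst
    have h1 : ∫⁻ a, ∫⁻ b, F (a, b) ∂(μ t) ∂(μ t) + ∫⁻ x₁, ∫⁻ x₂, edist x₁ x₂ ∂(μ s) ∂(μ s) ≤
        (ENNReal.ofReal (β * r) + ENNReal.ofReal (Real.sqrt (H * α) * r)) +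
          ∫⁻ x₁, ∫⁻ x₂, edist x₁ x₂ ∂(μ s) ∂(μ s) :=
      calc ∫⁻ a, ∫⁻ b, F (a, b) ∂(μ t) ∂(μ t) + ∫⁻ x₁, ∫⁻ x₂, edist x₁ x₂ ∂(μ s) ∂(μ s)
          ≤ ∫⁻ y₁, ∫⁻ y₂, edist y₁ y₂ ∂(μ t) ∂(μ t) +
              (ENNReal.ofReal (H * ((t : ℝ) - s))) ^ (1 / 2 : ℝ) := h44
        _ ≤ (∫⁻ x₁, ∫⁻ x₂, edist x₁ x₂ ∂(μ s) ∂(μ s) + ENNReal.ofReal (β * r)) +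
              ENNReal.ofReal (Real.sqrt (H * α) * r) := add_le_add hdiff hsqrt
        _ = _ := by ring
    have h2 := (ENNReal.add_le_add_iff_right hfin).1 h1
    refine h2.trans ?_
    rw [← ENNReal.ofReal_add (by positivity) (by positivity)]
    refine ENNReal.ofReal_le_ofReal ?_
    nlinarith [Real.sqrt_nonneg (H * α)]
  -- Chebyshev on `B(y₁, r) × B(y₂, r)`: some `(y'₁, y'₂)` there has `F ≤ M`
  set M : ℝ≥0∞ := ENNReal.ofReal ((β + 3 * Real.sqrt (H * α)) * r / γ) with hM
  have hMtop : M ≠ ∞ := ENNReal.ofReal_ne_top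
  set S : Set (𝒳.Slice t × 𝒳.Slice t) := ball y₁ r ×ˢ ball y₂ r with hS
  have hSm : MeasurableSet S := isOpen_ball.measurableSet.prod isOpen_ball.measurableSet
  have hex : ∃ p ∈ S, F p ≤ M := by
    by_contra hne
    simp only [not_exists, not_and, not_le] at hne
    set π : Measure (𝒳.Slice t × 𝒳.Slice t) := ((μ t).prod (μ t)).restrict S with hπ
    have hπS : π univ = μ t (ball y₁ r) * μ t (ball y₂ r) := by
      rw [hπ, Measure.restrict_apply_univ, hS, Measure.prod_prod]
    have hπ0 : π ≠ 0 := by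
      intro h0
      have h1 : π univ = 0 := by simp only [h0, Measure.coe_zero, Pi.zero_apply]
      rw [hπS] at h1
      rw [h1] at hmass
      exact (ENNReal.ofReal_pos.2 hγ).ne' (le_antisymm hmass bot_le)
    have hconst : ∫⁻ _, M ∂π ≠ ∞ := by
      rw [lintegral_const]
      exact ENNReal.mul_ne_top hMtop (measure_ne_top _ _)
    have hlt : ∫⁻ _, M ∂π < ∫⁻ p, F p ∂π :=
      lintegral_strict_mono hπ0 hFm.aemeasurable hconst
        ((ae_restrict_iff' hSm).2 (Eventually.of_forall fun p hp ↦ hne p hp))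
    have hup : ∫⁻ p, F p ∂π ≤ ENNReal.ofReal ((β + 3 * Real.sqrt (H * α)) * r) :=
      calc ∫⁻ p, F p ∂π ≤ ∫⁻ p, F p ∂((μ t).prod (μ t)) := lintegral_mono' Measure.restrict_le_self le_rfl
        _ = ∫⁻ a, ∫⁻ b, F (a, b) ∂(μ t) ∂(μ t) := lintegral_prod _ hFm.aemeasurable
        _ ≤ _ := hint
    have hlow : ENNReal.ofReal ((β + 3 * Real.sqrt (H * α)) * r) ≤ ∫⁻ _, M ∂π := by
      rw [lintegral_const, hπS]
      calc ENNReal.ofReal ((β + 3 * Real.sqrt (H * α)) * r)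
          = M * ENNReal.ofReal γ := by
            rw [hM, ← ENNReal.ofReal_mul (by positivity)]
            congr 1
            field_simp
        _ ≤ M * (μ t (ball y₁ r) * μ t (ball y₂ r)) := by gcongr
    exact lt_irrefl _ ((hlow.trans_lt hlt).trans_le hup)
  obtain ⟨⟨y₁', y₂'⟩, hpS, hFp⟩ := hex
  rw [hS, mem_prod, mem_ball, mem_ball] at hpS
  -- `F(y₁, y₂) ≤ F(y'₁, y'₂) + 2 d(y₁, y'₁) + 2 d(y₂, y'₂) ≤ M + 4r`
  have hFy : F (y₁, y₂) ≤ M + ENNReal.ofReal (4 * r) :=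
    calc F (y₁, y₂) ≤ F (y₁', y₂) + 2 * edist y₁ y₁' := hF₁ _ _ _
      _ ≤ (F (y₁', y₂') + 2 * edist y₂ y₂') + 2 * edist y₁ y₁' := add_le_add (hF₂ _ _ _) le_rfl
      _ ≤ (M + 2 * ENNReal.ofReal r) + 2 * ENNReal.ofReal r := by
          gcongr
          · rw [edist_comm, edist_dist]; exact ENNReal.ofReal_le_ofReal hpS.2.le
          · rw [edist_comm, edist_dist]; exact ENNReal.ofReal_le_ofReal hpS.1.le
      _ = M + ENNReal.ofReal (4 * r) := by
          rw [show (4 : ℝ) * r = 2 * r + 2 * r by ring, ENNReal.ofReal_add (by positivity)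
            (by positivity), ENNReal.ofReal_mul zero_le_two, ENNReal.ofReal_ofNat]
          ring
  -- conclude
  have hfinal : edist y₁ y₂ ≤ (M + ENNReal.ofReal (4 * r)) + W (y₁, y₂) :=
    tsub_le_iff_right.1 hFy
  calc edist y₁ y₂ ≤ (M + ENNReal.ofReal (4 * r)) + W (y₁, y₂) := hfinal
    _ = W (y₁, y₂) + ENNReal.ofReal (((β + 3 * Real.sqrt (H * α)) / γ + 4) * r) := by
        rw [add_comm, hM, ← ENNReal.ofReal_add (by positivity) (by positivity)]
        congr 2
        field_simp

end MetricFlow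

end Literature.Geometry.Riemannian

end
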